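import Mathlib
import HarnessLib
import HarnessLib.Audit
import Summits.PneNP.Statement
import Literature.Computability.Complexity.Classes
import Literature.Computability.Complexity.Nondeterministic
import Literature.Computability.Complexity.CookBridges
import Literature.Computability.Complexity.PolyHierarchy
import Literature.Computability.Cryptography.ClassBQP
import Literature.Computability.QuantumComplexity.RazTalForrelation
import Literature.Computability.QuantumComplexity.OracleSeparationsProofs
import Literature.Computability.Complexity.ProbabilisticClasses
import Literature.Computability.Complexity.Counting
import Literature.Computability.Complexity.Oracle
import Literature.Computability.QuantumComplexity.CountingSimulation
import Literature.Computability.QuantumComplexity.CountingSimulationRel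

/-!
Route: RootDecompQuantumCell

DORMANT since 2026-09-04T13:53:07Z (reconciler: no traction for 5 d (last activity item-proof-filed at 2026-08-30T12:48:02Z); parked, not closed — `ledger route dormant route-PneNP-RootDecompQuantumCell --off` to reactivate) — unstaffed, not closed; items shared with open routes are served there. `ledger route dormant <id> --off` reactivates.

# Route RootDecompQuantumCell — Root decomposition on the BQP cell of Algorithmica

Root-decomposition cell decomp-pnenp, node N19 (lens-6 gen 7 «QuantumCell — the BQP cell / the other
summit as cut predicate», HOME/decomp-pnenp-lens-6/
QuantumCell.lean sha256 d8b44819, NODE-g7.md 480e8bab; critic decomp-pnenp-crit-1 g3 CLEARED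
2026-08-30T06:47:12Z, scores once (vii) as the C = BQP
cell of the class-cell schema). It suffices to show X = T ∧ R, the generic law-D cut of S along Y :=
«BQP ⊆ P» over the tree's uniform Clifford+T class
`Literature.Computability.Cryptography.BQP`: T = `QTransfer` (NP ⊆ P → BQP ⊄ P, «Algorithmica cannot
simulate quantum computers»; crux r2, ATTACKED;
kernel `qTransfer_iff : T ↔ PneNP ∨ QuantumAdvantage` — the programme's SECOND SUMMIT is the cut
bit) and R = `QLift` (NP ⊆ P → BQP ⊆ P; crux r3,
DECLARED RESIDUAL; kernel `qLift_iff : R ↔ PneNP ∨ ¬QuantumAdvantage`, R ≤ hub K =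
RootDecompSpaceCeiling.CollapseLift and R ≤ LiftPSpace in kernel).
S ↔ T ∧ R hypothesis-free (`pneNP_iff_quantumCell`). COUNTING-SANDWICH COORDINATE (rev 1–2; lens-4
g13 «RootDecompCountingSandwich», critic
CLEARED 2026-08-30T11:28:01Z as located hub K-cell #4, no residual score): the residual R is the
LOWER factor of the hub, K ⟺ QLift ∧ QCatch hypothesis-free
(aside `QCellIff`, PROVED) with QCatch = «NP ⊆ P → PP ⊆ BQP» the relativized-STRICTLY-WEAKER co-heir
(holds at AIK22 Thm 10's world where K and R fail)
and R the two-sided heir; typed tests `TQC` ⟺ `TQL` ∨ `TQI` (aside `QTestsDichotomy`, PROVED mod P^B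
⊆ BQP^B); REV 4 (lens-4 g14, critic CLEARED 2026-08-30T12:08:03Z):
`TQC` and `TQI` DECIDED TRUE in print modulo the page-verified binder «AIK22 Thm-4 world»
(arXiv:2111.10409 Thm 4 = Cor 45, read through Cor 43 / Claim 44;
aside `QTestsDecided`, PROVED) — QCatch is two-sided non-relativizing AND strictly below K, and
`TQL` («P = NP = BQP ≠ PP») is the cell's ONE open test; `AWCatch` the
weakest strict piece. All record asides; cone unchanged. No card realised (cell node).
Lean: `(Literature.Computability.Complexity.Nondeterministic.NP ⊆
Literature.Computability.Complexity.Classes.P → ¬ (Literature.Computability.Cryptography.BQP ⊆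
Literature.Computability.Complexity.Classes.P)) ∧
(Literature.Computability.Complexity.Nondeterministic.NP ⊆
Literature.Computability.Complexity.Classes.P → Literature.Computability.Cryptography.BQP ⊆
Literature.Computability.Complexity.Classes.P)`

## Assembly
Pure logic over the tree's `pneNP_shape_iff_P_ne_NP` (N10's kernel pattern): `closes (hT :
QTransfer) (hR : QLift) : PneNP := by by_contra hS; … exact hT
heq.symm.subset (hR heq.symm.subset)` (glue.lean; cone = {QTransfer, QLift}; every other item is an
ASIDE — banked context, never staffed; the print
binders AIKWorld / DoubleCollapseWorld / BQPRelSubsetPSPACEOfMem of the lens file are census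
instruments, deliberately NOT items). Conjunct split
S ↔ T ∧ R: attacked = QTransfer, declared residual = QLift (tribunal_fit).

Rationale: WHY THIS LINE. The mechanism is the class-cell schema of N3 (PP / PSPACE) and N10 (⊕P) — cut S ⟺ (S
∨ Y) ∧ (S ∨ ¬Y) along Y = «C ⊆ P» read inside Algorithmica —
at the one class no node used and whose cut bit is the programme's other summit: C = BQP, where (BPP
= P inside Algorithmica by Sipser–Gács–Lautemann,
kernel `lift_BPP`) ¬Y ⟺ QuantumAdvantage (`quantumAdvantage_iff_qTransfer_of_not_pneNP`). Imported
from quantum complexity: the relativized worlds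
that make both pieces STRICTLY WEAKER than S — Aaronson–Ingram–Kretschmer CCC 2022 Thm 10
(arXiv:2111.10409: P = NP ≠ BQP = P^{#P}, so R has no
relativizing proof; typed binder `AIKWorld`, kernel `not_relativizes_qLift_of_aik`) and the
doubly-collapsing PSPACE-complete world (FortnowRogers1999JCSS
Thm 4.2 / BernsteinVazirani1997SICOMP Thm 8.4: P = NP = BQP, so T has no relativizing proof;
HALF-DISCHARGED in kernel `doubleCollapseWorld_of_bv` from the
tree's `exists_isComplete_PSPACE_holds` + `PRel_eq_PSPACE_of_isComplete_PSPACE_of` modulo the single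
print binder relativized BV 8.4); the decided rung
beneath BQP^A ⊄ PH^A (Raz–Tal JACM 2022 Thm 7.4, tree theorem `razTal2022_thm74_of_tal
Tal2017_fourierL1_ac0_holds`); and AIK's open question «Suppose
P = NP. Does it follow that BQP is small?» (arXiv:2111.10409 p.3, p.5) which IS the residual R. What
no prior route / negatives entry does: N3 cuts at
PP/PSPACE, N10 at ⊕P, N14 along alternation depth; no PneNP Theses file or negatives row mentions
BQP; the kernel places R BELOW the residual of record
K (`qLift_of_collapseLift`, via tree `BQP_subset_PP_holds`) with strictness R < K a NAMED TEST T_Q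
(a world with P = NP ⊇ BQP and PP ⊄ P is not in print). REV 1–2 (writer g7) adds the
COUNTING-SANDWICH
coordinate of K at BQP as record asides (lens-4 g13, HOME/decomp-pnenp-lens-4/CountingSandwich.lean
sha256 be3d77d5; critic 11:28:01Z K-cell #4): QCatch (stmt-PneNP-32697) with K ⟺ QLift ∧ QCatch
(QCellIff, kernel `qCellIff_holds`), the typed tests TQC / TQL / TQI (32698 / 32699 / 32700; T_Q =
TQL) with TQC ⟺ TQL ∨ TQI (QTestsDichotomy, kernel
`qTestsDichotomy_holds`), and AWCatch (32701); writer certificate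
HOME/decomp-pnenp-writer-1/N19QC_items-g7.lean sha256 e5786c31 (farm rc 0, 0 sorry, 11/11 AXOK). REV
4 (writer g8; lens-4 g14 «CountingSandwich g14», HOME/decomp-pnenp-lens-4/CountingSandwich-g14.lean
sha256 bc278d2b; critic CLEARED
2026-08-30T12:08:03Z, page-verified, probe HOME/critic/L4_CountingSandwich_g14_probe.lean 3a5246c6
160/160 AXOK): the tests TQC / TQI are DECIDED TRUE in print modulo the binder
AIKFour = «AIK22 Thm-4 world» (∃ B, NP^B ⊆ P^B ∧ ∃ L M, M ∈ BQP^B ∧ L ∉ BQP^B ∧ L ∈ PP^B ∧ (M ∈ P^B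
→ L ∈ NP^B): three page clauses of arXiv:2111.10409 — P^𝒪 = NP^𝒪 and
L^A ∉ BQP^𝒪 (Cor 45 p.25), M^A ∈ BQP^A (Claim 44 p.24) — plus three relativizing textbook closures;
print-derivable, hypothesis-grade like AIKTen) — PROVED record
aside QTestsDecided (kernel `qTestsDecided_holds`, certificate
HOME/decomp-pnenp-writer-1/N19g14_items-g8.lean sha256 9d482f02, rc 0 / 0 sorry / 5/5 AXOK); hence
QCatch is
BARRIER[REL] two-sided (fails at the Thm-4 world) AND strictly below K (holds at the Thm-10 world),
the hub K has TWO independent print failing worlds, and the world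
table of the BQP cell reads (T,T) PSPACE oracles · (F,T) Thm 10 · (F,F) Thm 4 · (T,F) ⟺ TQL OPEN. No
score (cap (vii)); cone / closes / tribunal_fit unchanged.

RANKED CRUXES. #2 QTransfer (crux) — PIECE T (attacked): if NP ⊆ P then BQP ⊄ P — Algorithmica
cannot simulate polynomial-time quantum computation (lens decl `QTransfer := Nondeterministic.NP ⊆
Classes.P → ¬ (BQP ⊆ Classes.P)`, inlined). Kernel: T ↔ PneNP ∨ QuantumAdvantage ↔ PneNP ∨ (BQP ⊄
P); T → P ≠ PP and T → RootDecompSpaceCeiling.ShadowPSpace (stmt 23701). [difficulty: open-problem]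
(why it might fail: False relative to every PSPACE-complete oracle (P = NP = BQP there; kernel
`not_relativizes_qTransfer_of_dc` mod relativized BV Thm 8.4), so only a non-relativizing proof can
exist; its S-free roads are P ≠ BQP / the QuantumAdvantage summit itself.) [arXiv:2111.10409,
FortnowRogers1999JCSS, BernsteinVazirani1997SICOMP, HOME/decomp-pnenp-lens-6/QuantumCell.lean sha256
d8b44819]
#3 QLift (crux) — PIECE R (DECLARED RESIDUAL): if NP ⊆ P then BQP ⊆ P — Algorithmica simulates
quantum computers; exactly Aaronson–Ingram–Kretschmer's open question «Suppose P = NP. Does it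
follow that BQP is small?» (lens decl `QLift := Nondeterministic.NP ⊆ Classes.P → BQP ⊆ Classes.P`,
inlined). Kernel: R ↔ PneNP ∨ ¬QuantumAdvantage; R ≤ K (RootDecompSpaceCeiling.CollapseLift, stmt
23703) and R ≤ LiftPSpace (23705); decided classical-coin layer `lift_BPP` (NP ⊆ P → BPP ⊆ P).
[deps: QTransfer] [difficulty: open-problem] (why it might fail: FALSE relative to the
Aaronson–Ingram–Kretschmer oracle (P = NP ≠ BQP = P^{#P}, CCC 2022 Thm 10; kernel
`not_relativizes_qLift_of_aik`): no relativizing proof; its only believed road is hub K (NP ⊆ P → PP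
⊆ P), itself the residual of record.) [arXiv:2111.10409, Aaronson2010,
HOME/decomp-pnenp-lens-6/QuantumCell.lean sha256 d8b44819]
#9 PneBQP (support) — ROAD TO T (ASIDE, banked context): P ≠ BQP, i.e. BQP ⊄ P — weaker than the
QuantumAdvantage summit (P ⊆ BPP), gives QTransfer outright (`qTransfer_of_pneBQP`; kernel
`qTransfer_iff_pneNP_or_pneBQP : T ↔ S ∨ PneBQP`). OPEN. [difficulty: open-problem] [Aaronson2010,
arXiv:2111.10409]
#9 BQPInPH (support) — ROAD TO R (ASIDE, banked context; believed FALSE, relativized-false in kernel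
`not_relativizes_bqpInPH` from Raz–Tal): BQP ⊆ PH — gives QLift since PH = P in Algorithmica
(`qLift_of_bqpInPH`, Meyer–Stockmeyer `ph_subset_P_of_collapse`); AIK22 p.5 names the stronger «BQP
⊆ AM» road. [difficulty: open-problem] [arXiv:2111.10409, Aaronson2010]
#9 ForrelationRung (support) — DECIDED RUNG on T's typed surface (ASIDE, PROVABLE NOW:
`razTal2022_thm74_of_tal Tal2017_fourierL1_ac0_holds`, tree theorems; packaged
`RazTal2022_thm74_holds` in the unbuilt Proofs module): Raz–Tal Thm 7.4 — the Forrelation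
distribution fools bounded-depth circuits, the restricted-model theorem beneath BQP^A ⊄ PH^A (BC5
witness of the cell: quantum-vs-classical separation decided in the bounded-depth / oracle model
where S is undecided). [difficulty: provable-now] [RazTalJACM2022, Tal2017]

TWO-LAYER PLAN. Foreseen split of QTransfer once attacked directly: T ⇐ PneBQP (road, aside) or T ⇐
QuantumAdvantage (cross-summit edge `qTransfer_of_quantumAdvantage`,
kernel) — either child is an S-free statement of the quantum programme; T ⇐ P ≠ PP is NOT a child (T
→ P ≠ PP is the proved direction). Foreseen
split of QLift (if ever attacked): R ⇐ K (RootDecompSpaceCeiling.CollapseLift, kernel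
`qLift_of_collapseLift`) — no new item, the edge is booked.
Nothing filed now.

KILL CRITERIA. `refuted:QTransfer` needs NP ⊆ P ∧ BQP ⊆ P outright (i.e. ¬S ∧ ¬QuantumAdvantage) — a
refutation of T refutes the summit itself, so T is only
killable together with S; `refuted:QLift` needs NP ⊆ P ∧ BQP ⊄ P (¬S ∧ QuantumAdvantage), likewise
summit-deciding. Informative non-kills the
refuter CAN run: (i) a world with P = NP = BQP and PP ⊄ P (test T_Q = aside TQL stmt-PneNP-32699,
the ONE open test after rev 4) decides the strictness R < K and re-draws the
residual chart — its companions TQC 32698 «P = NP ∧ PP ⊄ BQP» and TQI 32700 «P = NP ∧ BQP strictly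
intermediate» (TQC ⟺ TQL ∨ TQI) are DECIDED TRUE in print
modulo the AIK22 Thm-4 binder (aside QTestsDecided, rev 4): the OTHER new configuration (BQP
strictly intermediate inside a collapsing world) already exists; (ii) a proof of
BQP ⊆ PH (aside BQPInPH, believed false) would close R outright and make T ≡ S (the cell degenerates
to COSTUME); (iii) a proof of QuantumAdvantage
(other summit) closes T and makes R ≡ S. The route is retired `superseded` if (ii) or (iii) lands.

NOT DECOMPOSED YET. The direct roads for T (beyond the other summit / P ≠ BQP) and for R (AIK's
question: a non-black-box simulation of BQP from an NP-complete oracle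
collapse); the port of the lens kernel (`qTransfer_iff`, `qLift_iff`, `pneNP_iff_quantumCell`,
`lift_BPP`, `qLift_of_collapseLift`, `qLift_of_liftPSpace`,
`not_PP_subset_P_of_qTransfer`, `shadowPSpace_of_qTransfer`, `forrelationRung_holds`, the
relativized tag theorems) to Theorems/ — layer-2 / prover work.
Also lander work (provable now, LANDING LIST on the cell bus): the PROVED record asides QCellIff and
QTestsDichotomy (kernel proofs
`qCellIff_holds` / `qTestsDichotomy_holds`, writer certificate
HOME/decomp-pnenp-writer-1/N19QC_items-g7.lean sha256 e5786c31 and landing file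
N19QC_landing-g7.lean a1dc918f)
and QTestsDecided (rev 4; kernel `qTestsDecided_holds`,
HOME/decomp-pnenp-writer-1/N19g14_items-g8.lean sha256 9d482f02); the S-free support port of the
whole
coordinate (lens-4 g14/RootDecompSpaceCeilingCountingSandwich.lean e642c5ae, 69 theorems,
critic-endorsed `--supports stmt-PneNP-23703`).

CHEAPEST FALSIFIER. Lookup T_Q (run by lens-6 g7 and the critic, 2026-08-30): is there an oracle
with P = NP ⊇ BQP and PP ⊄ P, or one with P = NP and BQP ⊆ P other than
PSPACE-complete ones? — corpus hybrid «oracle relative to which P = NP but BQP is not contained in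
P; does P = NP imply P = BQP» → textbooks only;
galaxy --star all needles "P = NP but BQP|NP ⊆ P and BQP|P=NP implies P=BQP|BQP is small" → 0
relevant hits; the P = NP ≠ BQP worlds in print are AIK22 Thm 10
(arXiv:2111.10409 p.8: BQP = P^{#P}) and — booked at rev 4 — AIK22 Thm 4 (p.6 / Cor 45 p.25: BQP ≠
QCMA, read as P = NP, BQP ⊄ P, PP ⊄ BQP, i.e. TQI ✓ / TQC ✓);
the TQL configuration (P = NP = BQP, PP ⊄ P) stays absent from print (AIK22 §6 obstacle; corpus +
galaxy null, lens-4 g13/g14 logs). A TQL world is informative (chart), never kills. Not runnable by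
kit (kit_allowed = false).

NUMBERS. Cone 2/2 (unchanged through rev 4); items 14 after rev 4 (2 cruxes + 11 asides + Assembly;
rev 0: 6, rev 2: 13); N19QC certificate 11/11 theorems AXOK; N19g14 certificate 5/5 AXOK; lens
kernel 33/33 decls AXOK {propext, Classical.choice, Quot.sound} (critic probe
L6_QuantumCell_g7_probe.lean 3a53c588); BC7 2/2 CLEAN vs PneNP and 2/2 CLEAN vs QuantumAdvantage
(lens bc/bc7_verdicts_g7.txt; writer re-run 2/2 CLEAN);
relativized worlds typed: 1 (AIK, binder) + 1 (double collapse, half-discharged mod relativized BV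
8.4).

DEFINITION REQUESTS. None: `NP`, `Classes.P`, `PH`, `BQP`, `RazTal2022_thm74` are tree declarations
with oleans; the cell predicates are inlined. Port request (prover,
when idle): the lens kernel theorems listed under «Not decomposed yet» into
Summits/PneNP/PneNP/Theorems/RootDecompQuantumCell*.lean
(ForrelationRung closes by `razTal2022_thm74_of_tal Tal2017_fourierL1_ac0_holds`).

Novelty: Searches (2026-08-30, lens-6 g7 + critic g3 + writer): lit read arXiv:2111.10409 --grep (Thm 10 p.8
L29–31; p.5 L31 BQP ⊆ AM road; p.3 L39 open
question); lit search --hybrid «oracle relative to which P = NP but BQP is not contained in P; does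
P = NP imply P = BQP» (Arora–Barak, Sipser only);
lit galaxy search "P = NP but BQP|NP ⊆ P and BQP|P=NP implies P=BQP|P = NP implies P = BQP|BQP is
small" --star all (0 / 1 irrelevant / 0); lean search
'NP ⊆ Classes.P → BQP' and 'BQP ⊆ Classes.P' --decl (no tree decl of either shape); ledger negatives
--problem PneNP (0 rows on BQP); tree reads
Literature/Computability/QuantumComplexity/BQPCollapsingOracle.lean (Ko / FortnowRogers Thm 4.2),
OracleSeparationsProofs.lean (BV97 Thm 8.10, Raz–Tal
Cor 1.5), Literature/Barriers/QuantumAdvantage/Relativization.lean (bqpRelOf, scope caveats).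
Nearest prior art found: [corpus:paper:arxiv-2111.10409 p.8 Thm 10, p.3, p.5]
Aaronson–Ingram–Kretschmer pose R as an open question and build the
P = NP ≠ BQP world; in tree route-PneNP-RootDecompSpaceCeiling (N3: PP/PSPACE cells, hub K) and
route-PneNP-RootDecompParityCell (N10: ⊕P cell) use
the same schema at other classes; Summits/QuantumAdvantage route Dequantize states BQP ⊆ BPP
(DeqThesis) as a road, not a cut of PneNP.
Delta: the second summit (QuantumAdvantage) as the cut bit of the first, with both pieces certified
PneNP ∨ (±)QuantumAdvantage hypothesis-free and
their relativized strictness typed from the AIK and PSPACE-complete worlds — a new cel  [refs: 2111.10409, paper:arxiv-2111.10409]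

Barriers (technique_class: quantum-cell, law-D-carving, relativized-worlds): - technique_class: quantum-cell, law-D-carving, relativized-worlds
- Literature.Barriers.PneNP.Relativization: BOTH pieces INSIDE and exhibited both ways in kernel
modulo named print worlds — QTransfer false rel. every PSPACE-complete oracle
(`not_relativizes_qTransfer_of_dc`, world half-discharged by `doubleCollapseWorld_of_bv`) and true
rel. BV/Raz–Tal oracles with PH infinite only where the collapse fails; QLift false rel. the AIK
oracle (`not_relativizes_qLift_of_aik`, arXiv:2111.10409 Thm 10) — no evasion claimed; the bet is
that T goes through a (non-relativizing) proof of QuantumAdvantage / P ≠ PP and R through a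
non-black-box NP-oracle simulation of BQP.
- Literature.Barriers.PneNP.NaturalProofs: VOID for both implication shapes — no circuit lower bound
for an explicit function is claimed, and inside Algorithmica (NP ⊆ P) there are no hard PRGs, so the
barrier theorem's hypothesis fails (tree `not_isNaturalProofBQP_of_hard_prg` needs them); the
Forrelation rung is a bounded-depth theorem already proved (Raz–Tal), outside RR's scope.
- Literature.Barriers.PneNP.Algebrization: UNPLACED for the implication shapes — Aaronson–Wigderson
2009 place BQP vs BPP outright (tree `Algebrization.not_isAlgebrizingSeparation_bqp_bpp` /
`…Inclusion_bqp_bpp`), not «P = NP ∧ BQP ⊆/⊄ P»; honest: no algebraic-oracle pair for either piece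
in print (galaxy + corpus null queries listed under Novelty); priced as Relativization.
- Negatives index: 14 PneNP negatives at filing (+ SmallSegregato

History (route lifecycle, newest last):
- 2026-08-30T11:57:22Z · rev 3: informal re-worded for QCatch, TQC, AWCatch, QCellIff, QTestsDichotomy (planner-decomp-pnenp-writer-1-g7-0)
- 2026-08-30T12:09:29Z · rev 4: informal re-worded for QCatch, TQC, TQI (planner-decomp-pnenp-writer-1-g8-0)
- 2026-08-30T12:10:00Z · rev 4: informal re-worded for QCatch, TQC, TQI (planner-decomp-pnenp-writer-1-g8-0)
- 2026-08-30T12:10:13Z · rev 4: informal re-worded for QCatch, TQC, TQI (planner-decomp-pnenp-writer-1-g8-0)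
- 2026-08-30T12:10:19Z · rev 4: informal re-worded for QCatch, TQC, TQI (planner-decomp-pnenp-writer-1-g8-0)
- 2026-08-30T12:10:36Z · rev 4: informal re-worded for QCatch, TQC, TQI (planner-decomp-pnenp-writer-1-g8-0)
- 2026-09-04T13:53:07Z · DORMANT — reconciler: no traction for 5 d (last activity item-proof-filed at 2026-08-30T12:48:02Z); parked, not closed — `ledger route dormant route-PneNP-RootDecompQuant (operator:999:50325)

sub-problem: PneNP · status: dormant · opened planner-decomp-pnenp-writer-1-g4-0 2026-08-30T06:55:01Z · rev 4 · ledger route-PneNP-RootDecompQuantumCell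
GENERATED by the gate from the ledger (D-0016/17). Provers cite these decls: `theorem foo : Summit.PneNP.PneNP.Theses.RootDecompQuantumCell.<Decl> := …` in Summits/PneNP/PneNP/Theorems/<Name>.lean.
-/

namespace Summit.PneNP.PneNP.Theses.RootDecompQuantumCell

open scoped BigOperators Topology Manifold Classical MeasureTheory ProbabilityTheory Matrix InnerProductSpace ComplexConjugate ContinuousMap
open Filter Set Function TopologicalSpace MeasureTheory

attribute [summit_statement] _root_.PneNP

open Literature.PNP

/-- item stmt-PneNP-29731 · crux · rank 2 · open · by planner
why it might fail: False relative to every PSPACE-complete oracle (P = NP = BQP there; kernel `not_relativizes_qTransfer_of_dc` mod relativized BV Thm 8.4), so only a non-relativizing proof can exist; its S-free roads are P ≠ BQP / the QuantumAdvantage summit itself.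
sources: arXiv:2111.10409, FortnowRogers1999JCSS, BernsteinVazirani1997SICOMP, HOME/decomp-pnenp-lens-6/QuantumCell.lean sha256 d8b44819
[crux] PIECE T (attacked): if NP ⊆ P then BQP ⊄ P — Algorithmica cannot simulate polynomial-time
quantum computation (lens decl `QTransfer := Nondeterministic.NP ⊆ Classes.P → ¬ (BQP ⊆ Classes.P)`,
inlined). Kernel: T ↔ PneNP ∨ QuantumAdvantage ↔ PneNP ∨ (BQP ⊄ P); T → P ≠ PP and T →
RootDecompSpaceCeiling.ShadowPSpace (stmt 23701). [difficulty: open-problem] -/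
@[route_item "route-PneNP-RootDecompQuantumCell"]
def QTransfer : Prop :=
  Literature.Computability.Complexity.Nondeterministic.NP ⊆ Literature.Computability.Complexity.Classes.P → ¬ (Literature.Computability.Cryptography.BQP ⊆ Literature.Computability.Complexity.Classes.P)

/-- item stmt-PneNP-29732 · crux · rank 3 · open · by planner
why it might fail: FALSE relative to the Aaronson–Ingram–Kretschmer oracle (P = NP ≠ BQP = P^{#P}, CCC 2022 Thm 10; kernel `not_relativizes_qLift_of_aik`): no relativizing proof; its only believed road is hub K (NP ⊆ P → PP ⊆ P), itself the residual of record.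
sources: arXiv:2111.10409, Aaronson2010, HOME/decomp-pnenp-lens-6/QuantumCell.lean sha256 d8b44819
[crux] PIECE R (DECLARED RESIDUAL): if NP ⊆ P then BQP ⊆ P — Algorithmica simulates quantum
computers; exactly Aaronson–Ingram–Kretschmer's open question «Suppose P = NP. Does it follow that
BQP is small?» (lens decl `QLift := Nondeterministic.NP ⊆ Classes.P → BQP ⊆ Classes.P`, inlined).
Kernel: R ↔ PneNP ∨ ¬QuantumAdvantage; R ≤ K (RootDecompSpaceCeiling.CollapseLift, stmt 23703) and R
≤ LiftPSpace (23705); decided classical-coin layer `lift_BPP` (NP ⊆ P → BPP ⊆ P). [deps: QTransfer]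
[difficulty: open-problem] -/
@[route_item "route-PneNP-RootDecompQuantumCell"]
def QLift : Prop :=
  Literature.Computability.Complexity.Nondeterministic.NP ⊆ Literature.Computability.Complexity.Classes.P → Literature.Computability.Cryptography.BQP ⊆ Literature.Computability.Complexity.Classes.P

/-- item stmt-PneNP-29733 · aside · rank 9 · open · by planner
sources: Aaronson2010, arXiv:2111.10409
[aside] ROAD TO T (ASIDE, banked context): P ≠ BQP, i.e. BQP ⊄ P — weaker than the QuantumAdvantage
summit (P ⊆ BPP), gives QTransfer outright (`qTransfer_of_pneBQP`; kernel
`qTransfer_iff_pneNP_or_pneBQP : T ↔ S ∨ PneBQP`). OPEN. [difficulty: open-problem] -/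
@[route_item "route-PneNP-RootDecompQuantumCell"]
def PneBQP : Prop :=
  ¬ (Literature.Computability.Cryptography.BQP ⊆ Literature.Computability.Complexity.Classes.P)

/-- item stmt-PneNP-29734 · aside · rank 9 · open · by planner
sources: arXiv:2111.10409, Aaronson2010
[aside] ROAD TO R (ASIDE, banked context; believed FALSE, relativized-false in kernel
`not_relativizes_bqpInPH` from Raz–Tal): BQP ⊆ PH — gives QLift since PH = P in Algorithmica
(`qLift_of_bqpInPH`, Meyer–Stockmeyer `ph_subset_P_of_collapse`); AIK22 p.5 names the stronger «BQP
⊆ AM» road. [difficulty: open-problem] -/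
@[route_item "route-PneNP-RootDecompQuantumCell"]
def BQPInPH : Prop :=
  Literature.Computability.Cryptography.BQP ⊆ Literature.Computability.Complexity.PH

/-- item stmt-PneNP-29735 · aside · rank 9 · closed · proved by Summit.PneNP.PneNP.Theorems.forrelationRung_proof (prover) · by planner
sources: RazTalJACM2022, Tal2017
[aside] DECIDED RUNG on T's typed surface (ASIDE, PROVABLE NOW: `razTal2022_thm74_of_tal
Tal2017_fourierL1_ac0_holds`, tree theorems; packaged `RazTal2022_thm74_holds` in the unbuilt Proofs
module): Raz–Tal Thm 7.4 — the Forrelation distribution fools bounded-depth circuits, the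
restricted-model theorem beneath BQP^A ⊄ PH^A (BC5 witness of the cell: quantum-vs-classical
separation decided in the bounded-depth / oracle model where S is undecided). [difficulty:
provable-now] -/
@[route_item "route-PneNP-RootDecompQuantumCell"]
def ForrelationRung : Prop :=
  Literature.Computability.QuantumComplexity.RazTal2022_thm74

-- `ForrelationRung` holds: proved by `Summit.PneNP.PneNP.Theorems.forrelationRung_proof` (its module imports this route file, so no `_holds` link can be stated here).

/-- item stmt-PneNP-32697 · aside · rank 9 · open · by planner
sources: arXiv:2111.10409, AaronsonIngramKretschmer2022, AdlemanDeMarraisHuang1997, Aaronson2005, FortnowRogers1999JCSS, BernsteinVazirani1997SICOMP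
[aside] QCatch «in Algorithmica quantum computers can count»: NP ⊆ P → PP ⊆ BQP (UNDECIDED record;
never staffed). COUNTING-SANDWICH coordinate of the hub residual K =
RootDecompSpaceCeiling.CollapseLift (stmt-PneNP-23703) at 𝒞 = BQP (lens-4 g13/g14; critic 11:28:01Z
K-cell #4, 12:08:03Z): K ⟺ QLift (29732) ∧ QCatch hyp-free (QCellIff 32710, PROVED). TAGS: WEAKER ·
NECESSARY · NOT COSTUME (given QLift it IS K) · STRICTLY BELOW K relativized, DECIDED mod AIK22 Thm
10 (holds at Thm 10's «P = NP ≠ BQP = P^{#P}» world, where K and QLift fail) · BARRIER[REL]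
TWO-SIDED, DECIDED mod AIK22 Thm 4 (FAILS at the «P = NP but BQP ≠ QCMA» world, arXiv:2111.10409 Cor
45 read through Cor 43 / Claim 44: P = NP, BQP ⊄ P, PP ⊄ BQP — sibling QTestsDecided, PROVED) ⇒
NEITHER factor of K at BQP has a relativizing proof · transfer QCatch ↔ (PP ⊄ BQP → S) · CO-HEIR of
K's certificate, strictly stronger than «QLift → K» at the Thm-4 world · tests TQC (32698) ✓ / TQI
(32700) ✓ DECIDED, TQL (32699) OPEN = the cell's one open certificate. Certificates
HOME/decomp-pnenp-writer-1/N19QC_items-g7.lean e5786c31, N19g14_items-g8.lean 9d482f02. -/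
@[route_item "route-PneNP-RootDecompQuantumCell"]
def QCatch : Prop :=
  Literature.Computability.Complexity.Nondeterministic.NP ⊆ Literature.Computability.Complexity.Classes.P → Literature.Computability.Complexity.PP ⊆ Literature.Computability.Cryptography.BQP

/-- item stmt-PneNP-32698 · aside · rank 9 · open · by planner
sources: arXiv:2111.10409, AaronsonIngramKretschmer2022, FortnowRogers1999JCSS, BernsteinVazirani1997SICOMP, FennerFortnowKurtzLi2003IC, HOME/decomp-pnenp-lens-4/CountingSandwich.lean sha256 be3d77d5
[aside] TEST T_QC (typed record; never staffed): ∃ B with NP^B ⊆ P^B and PP^B ⊄ BQP^B — «a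
collapsing world where quantum computers cannot count» = QCatch (32697) FAILS relative to some P =
NP oracle (critic anchor 11:56:04Z: TQC ↔ TwoSided(CatchRel)). STATUS (rev 4; lens-4 g14, critic
12:08:03Z): DECIDED TRUE IN PRINT modulo the page-verified binder «AIK22 Thm-4 world» (sibling
QTestsDecided, PROVED: binder → TQC): arXiv:2111.10409 Thm 4 (p.6) «P = NP but BQP ≠ QCMA» = Cor 45
(p.25: 𝒪 = (A,B), B codes NP answers so P^𝒪 = NP^𝒪; L^A ∉ BQP^𝒪 w.p. 1) with Cor 43 / Claim 44
(p.24: L^A ∈ NP^{M^A}, M^A ∈ BQP^A) and the relativizing closure NP^M ⊆ PP^M ⊆ PP^{BQP} = PP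
(Fortnow–Rogers: BQP is low for PP) ⇒ PP^𝒪 ⊄ BQP^𝒪 while P^𝒪 = NP^𝒪. SUPERSEDES the rev-0–3 status
«not in print either way». DICHOTOMY (QTestsDichotomy 32711, PROVED): TQC ⟺ TQL (32699) ∨ TQI
(32700) mod P^B ⊆ BQP^B; the Thm-4 world realises the TQI disjunct; TQL stays OPEN. Re-draws the
residual chart of K (second failing world of K: both BQP factors fail there); never touches S. -/
@[route_item "route-PneNP-RootDecompQuantumCell"]
def TQC : Prop :=
  ∃ B : Language Bool, Literature.Computability.Complexity.NPRel (Literature.Computability.Complexity.Oracle.ofLanguage B) ⊆ Literature.Computability.Complexity.PRel (Literature.Computability.Complexity.Oracle.ofLanguage B) ∧ ¬ (Literature.Computability.Complexity.PPRel (Literature.Computability.Complexity.Oracle.ofLanguage B) ⊆ Literature.Computability.Cryptography.BQPRel B)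

/-- item stmt-PneNP-32699 · aside · rank 9 · open · by planner
sources: arXiv:2111.10409, AaronsonIngramKretschmer2022, FortnowRogers1999JCSS, HOME/decomp-pnenp-lens-4/CountingSandwich.lean sha256 be3d77d5
[aside] TEST T_QL (typed, UNDECIDED record; = the route's original strictness test T_Q, CHEAPEST
FALSIFIER (i) of the rationale, now typed): «a collapsing world with BQP small and PP large» — ∃ B
with NP^B ⊆ P^B, BQP^B ⊆ P^B and PP^B ⊄ P^B. MEANING (kernel `tQL_iff_qLift_strict` in the writer
certificate): TQL ⟺ ∃ B, (relativized QLift holds at B) ∧ (relativized K fails at B) — i.e. TQL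
DECIDES that the declared residual QLift (stmt-PneNP-29732) is relativized-STRICTLY below the hub K
(stmt-PneNP-23703); today QLift is only known to be the two-sided HEIR (fails at AIK22 Thm 10
together with K; holds at PSPACE-complete worlds together with K). At a TQL-world QCatch fails too
(PP ⊄ P ⊇ BQP), so TQL ⟹ TQC (`tQC_of_tQL_or_tQI`). STATUS: NOT IN PRINT (searches as under TQC;
AIK22 asks precisely «Suppose P = NP. Does it follow that BQP is small?» — arXiv:2111.10409 p.3, p.5
— and exhibits only the opposite world, Thm 10). Census instrument only; never staffed. -/
@[route_item "route-PneNP-RootDecompQuantumCell"]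
def TQL : Prop :=
  ∃ B : Language Bool, Literature.Computability.Complexity.NPRel (Literature.Computability.Complexity.Oracle.ofLanguage B) ⊆ Literature.Computability.Complexity.PRel (Literature.Computability.Complexity.Oracle.ofLanguage B) ∧ Literature.Computability.Cryptography.BQPRel B ⊆ Literature.Computability.Complexity.PRel (Literature.Computability.Complexity.Oracle.ofLanguage B) ∧ ¬ (Literature.Computability.Complexity.PPRel (Literature.Computability.Complexity.Oracle.ofLanguage B) ⊆ Literature.Computability.Complexity.PRel (Literature.Computability.Complexity.Oracle.ofLanguage B))

/-- item stmt-PneNP-32700 · aside · rank 9 · open · by planner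
sources: arXiv:2111.10409, AaronsonIngramKretschmer2022, FennerFortnowKurtzLi2003IC, HOME/decomp-pnenp-lens-4/CountingSandwich.lean sha256 be3d77d5
[aside] TEST T_QI (typed record; the SURPLUS configuration of the counting-sandwich coordinate,
critic 11:28:01Z): ∃ B with NP^B ⊆ P^B, BQP^B ⊄ P^B and PP^B ⊄ BQP^B — «a collapsing world with BQP
strictly intermediate»; at a TQI-world BOTH factors of K fail (QLift: BQP ⊄ P; QCatch: PP ⊄ BQP)
while P = NP; TQI ⟹ TQC. STATUS (rev 4; lens-4 g14, critic 12:08:03Z): DECIDED TRUE IN PRINT modulo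
the binder «AIK22 Thm-4 world» and the tree fact P^B ⊆ BQP^B (sibling QTestsDecided, PROVED; lens
kernel ff_row): at Aaronson–Ingram–Kretschmer's «P = NP but BQP ≠ QCMA» oracle (arXiv:2111.10409 Thm
4 / Cor 45 p.25, with Cor 43 / Claim 44 p.24) one has P = NP, PP ⊄ BQP (L^A ∈ NP^{M^A} ⊆ PP^𝒪, L^A ∉
BQP^𝒪) and BQP ⊄ P (else M^A ∈ P^𝒪, so L^A ∈ NP^𝒪 = P^𝒪 ⊆ BQP^𝒪). SUPERSEDES the rev-0–3 text «the
natural candidate … is NOT in print»: the candidate IS AIK22 Thm 4. CHART of K's BQP cell over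
collapsing worlds: (T,T) PSPACE oracles · (F,T) Thm 10 · (F,F) Thm 4 · (T,F) ⟺ TQL (32699) OPEN.
Census instrument; never staffed; never touches S. -/
@[route_item "route-PneNP-RootDecompQuantumCell"]
def TQI : Prop :=
  ∃ B : Language Bool, Literature.Computability.Complexity.NPRel (Literature.Computability.Complexity.Oracle.ofLanguage B) ⊆ Literature.Computability.Complexity.PRel (Literature.Computability.Complexity.Oracle.ofLanguage B) ∧ ¬ (Literature.Computability.Cryptography.BQPRel B ⊆ Literature.Computability.Complexity.PRel (Literature.Computability.Complexity.Oracle.ofLanguage B)) ∧ ¬ (Literature.Computability.Complexity.PPRel (Literature.Computability.Complexity.Oracle.ofLanguage B) ⊆ Literature.Computability.Cryptography.BQPRel B)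

/-- item stmt-PneNP-32701 · aside · rank 9 · open · by planner
sources: FortnowRogers1999JCSS, Fenner2003, FennerFortnowKurtzLi2003IC, arXiv:2111.10409, HOME/decomp-pnenp-lens-4/CountingSandwich.lean sha256 be3d77d5
[aside] AWCatch «in Algorithmica gap-definable bounded acceptance catches counting»: NP ⊆ P → PP ⊆
AWPP (tree `QuantumComplexity.AWPP`; BQP ⊆ AWPP ⊆ PP by `BQP_subset_AWPP_holds` /
`AWPP_subset_PP_holds`, Fortnow–Rogers 1999, Fenner 2003). UNDECIDED record; never staffed. WEAKEST
STRICT PIECE of the counting-sandwich coordinate (critic 11:28:01Z; optional item): QCatch (32697) →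
AWCatch (awCatch_of_qCatch), K (23703) → AWCatch, S → AWCatch vacuously (awCatch_of_pneNP);
STRICT-BELOW-K mod AIKTen ALONE (at AIK22 Thm 10's world PP ⊆ BQP ⊆ AWPP while K fails). Its own
failure test T_AWC «∃ B, NP^B ⊆ P^B ∧ PP^B ⊄ AWPP^B» is typable over the tree's
`Literature.Computability.QuantumComplexity.AWPPRel` (declared in CountingSimulationRel;
`BQPRel_subset_AWPPRel_holds` in AccGapMachine) — not typed here, record only; not in print (critic
W-correction w1, ACK 11:56:04Z). Reading: the purely classical (GapP) shadow of «quantum computers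
can count», the meeting point with N3's counting instruments (edge by id: ≤ stmt-PneNP-23703). -/
@[route_item "route-PneNP-RootDecompQuantumCell"]
def AWCatch : Prop :=
  Literature.Computability.Complexity.Nondeterministic.NP ⊆ Literature.Computability.Complexity.Classes.P → Literature.Computability.Complexity.PP ⊆ Literature.Computability.QuantumComplexity.AWPP

/-- item stmt-PneNP-32710 · aside · rank 9 · closed · proved by Summit.PneNP.PneNP.Theorems.qCellIff_proof (prover) · by planner
sources: AdlemanDeMarraisHuang1997, BernsteinVazirani1997SICOMP, arXiv:2111.10409, HOME/decomp-pnenp-lens-4/CountingSandwich.lean sha256 be3d77d5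
[aside] EXACTNESS of the counting-sandwich coordinate, HYPOTHESIS-FREE, PROVED (writer certificate
HOME/decomp-pnenp-writer-1/N19QC_landing-g7.lean a1dc918f `qCellIff_proof :
RootDecompQuantumCell.QCellIff`, farm rc 0; critic anchor tree_qCellIff_holds, ACK 11:56:04Z
LANDING-READY; lander: --workitem stmt-PneNP-32710): K «NP ⊆ P → PP ⊆ P» (=
RootDecompSpaceCeiling.CollapseLift, stmt-PneNP-23703, inlined — no Theses import) ⟺ QLift (29732,
declared residual) ∧ QCatch (32697). Proof: → uses BQP ⊆ PP (`BQP_subset_PP_holds`,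
Adleman–DeMarrais–Huang 1997) and P ⊆ BQP (`P_subset_BPP_holds` ▸ `BPP_subset_BQP_holds`); ← is
transitivity. The sandwich law holds for every class P ⊆ 𝒞 ⊆ PP (lens-4 g13 Part I); BQP is the tree
class with BOTH factors undecided (at 𝒞 = BPP the lower factor is decided by Sipser–Gács–Lautemann,
so the upper factor ≡ K: COSTUME end). Reading for the hub: K's two-sided relativization certificate
splits as HEIR = QLift (fails at AIK22 Thm 10 with K) and CO-HEIR = QCatch (holds there) — critic
CO-HEIR LAW; one K-cell score (cap vii), no residual score, HONEST-NEGATIVE unchanged. -/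
@[route_item "route-PneNP-RootDecompQuantumCell"]
def QCellIff : Prop :=
  (Literature.Computability.Complexity.Nondeterministic.NP ⊆ Literature.Computability.Complexity.Classes.P → Literature.Computability.Complexity.PP ⊆ Literature.Computability.Complexity.Classes.P) ↔ (QLift ∧ QCatch)

-- `QCellIff` holds: proved by `Summit.PneNP.PneNP.Theorems.qCellIff_proof` (its module imports this route file, so no `_holds` link can be stated here).

/-- item stmt-PneNP-32711 · aside · rank 9 · closed · proved by Summit.PneNP.PneNP.Theorems.qTestsDichotomy_proof (prover) · by planner
sources: arXiv:2111.10409, FortnowRogers1999JCSS, FennerFortnowKurtzLi2003IC, HOME/decomp-pnenp-lens-4/CountingSandwich.lean sha256 be3d77d5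
[aside] DICHOTOMY of the typed tests, PROVED (writer certificate N19QC_landing-g7.lean a1dc918f
`qTestsDichotomy_proof : RootDecompQuantumCell.QTestsDichotomy`, farm rc 0; critic anchor
tree_qTestsDichotomy_holds, ACK 11:56:04Z LANDING-READY; lander: --workitem stmt-PneNP-32711):
modulo the tree NAMED FACT `PRel_ofLanguage_subset_BQPRel` «P^B ⊆ BQP^B» (CountingSimulationRel;
proved as `PRel_ofLanguage_subset_BQPRel_holds` in CountingSimulationRelProofs — a hypothesis here
only to keep the route on statement modules), TQC (32698) ⟺ TQL (32699) ∨ TQI (32700); TQL ∨ TQI →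
TQC is hyp-free (tQC_of_tQL_or_tQI). Proof: a TQC-world (P = NP, PP ⊄ BQP) either has BQP ⊆ P — then
PP ⊄ P, a TQL-world — or BQP ⊄ P, a TQI-world; conversely TQL gives PP ⊄ BQP via BQP ⊆ P and TQI has
it by definition. Reading: the failure test of the co-heir QCatch is exactly «QLift strictly below
K» (TQL = the route's old T_Q; kernel tQL_iff_qLift_strict) ∨ «BQP strictly intermediate inside
Algorithmica» (TQI) — one census lookup (TQC) settles whether the sandwich carries a certificate
beyond K's own. -/
@[route_item "route-PneNP-RootDecompQuantumCell"]
def QTestsDichotomy : Prop :=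
  Literature.Computability.QuantumComplexity.PRel_ofLanguage_subset_BQPRel → (TQC ↔ (TQL ∨ TQI))

-- `QTestsDichotomy` holds: proved by `Summit.PneNP.PneNP.Theorems.qTestsDichotomy_proof` (its module imports this route file, so no `_holds` link can be stated here).

/-- item stmt-PneNP-32933 · aside · rank 9 · closed · proved by Summit.PneNP.PneNP.Theorems.qTestsDecided_proof (prover) · by planner
sources: arXiv:2111.10409, AaronsonIngramKretschmer2022, FortnowRogers1999JCSS, BernsteinVazirani1997SICOMP, HOME/decomp-pnenp-lens-4/CountingSandwich-g14.lean, HOME/decomp-pnenp-writer-1/N19g14_items-g8.lean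
[aside] PROVED record (lens-4 g14; critic 12:08:03Z): the print binder «AIK22 Thm-4 world» — ∃ B,
NP^B ⊆ P^B, with languages M ∈ BQP^B, L ∉ BQP^B, L ∈ PP^B, (M ∈ P^B → L ∈ NP^B); each clause a page
line of arXiv:2111.10409 (Thm 4 p.6 = Cor 45 p.25; Cor 43 / Claim 44 p.24: L^A ∈ NP^{M^A}, M^A ∈
BQP^A, L^A ∉ BQP^𝒪) or one relativizing closure (NP^M ⊆ PP^M ⊆ PP^{BQP} = PP, Fortnow–Rogers;
NP^{P^𝒪} = NP^𝒪) — IMPLIES TQC (32698), and with the tree fact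
`QuantumComplexity.PRel_ofLanguage_subset_BQPRel` (P^B ⊆ BQP^B) also TQI (32700). Kernel
`qTestsDecided_holds` (pure logic over the binder), certificate
HOME/decomp-pnenp-writer-1/N19g14_items-g8.lean sha256 9d482f02 (= lens-4 g14/N19g14_items.lean;
farm rc 0 / 0 sorry / 5/5 AXOK, writer re-check g8). MEANING: both tests filed at rev 1 as
«UNDECIDED, not in print» are DECIDED TRUE in print modulo this hypothesis-grade binder; TQL (32699,
«P = NP = BQP ≠ PP», AIK22 §6's named obstacle) remains the ONE open test of the cell; the binder
world is a second failing world of K itself (`k_fails_at_thm4_world`). Landing-ready; never touches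
S or the cone {QTransfer, QLift}. -/
@[route_item "route-PneNP-RootDecompQuantumCell"]
def QTestsDecided : Prop :=
  (∃ B : Language Bool, Literature.Computability.Complexity.NPRel (Literature.Computability.Complexity.Oracle.ofLanguage B) ⊆ Literature.Computability.Complexity.PRel (Literature.Computability.Complexity.Oracle.ofLanguage B) ∧ ∃ L M : Language Bool, M ∈ Literature.Computability.Cryptography.BQPRel B ∧ L ∉ Literature.Computability.Cryptography.BQPRel B ∧ L ∈ Literature.Computability.Complexity.PPRel (Literature.Computability.Complexity.Oracle.ofLanguage B) ∧ (M ∈ Literature.Computability.Complexity.PRel (Literature.Computability.Complexity.Oracle.ofLanguage B) → L ∈ Literature.Computability.Complexity.NPRel (Literature.Computability.Complexity.Oracle.ofLanguage B))) → (TQC ∧ (Literature.Computability.QuantumComplexity.PRel_ofLanguage_subset_BQPRel → TQI))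

-- `QTestsDecided` holds: proved by `Summit.PneNP.PneNP.Theorems.qTestsDecided_proof` (its module imports this route file, so no `_holds` link can be stated here).

/-- item stmt-PneNP-29736 · assembly · rank 1 · open · by planner
sources: HOME/decomp-pnenp-lens-6/QuantumCell.lean sha256 d8b44819
[assembly] QTransfer → QLift → P ≠ NP. -/
@[route_item "route-PneNP-RootDecompQuantumCell"]
def Assembly : Prop :=
  QTransfer → QLift → PneNP

/-! D-0027 §2.1 — DECIDING THEOREM (planner-authored via `route open/edit --closes-file`; by planner-decomp-pnenp-writer-1-g4-0 2026-08-30T06:55:01Z):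
its hypotheses are this route's items and its conclusion the sub-problem Statement (glue_lint), and it elaborates with this file. -/

@[closes "route-PneNP-RootDecompQuantumCell"] theorem closes (hT : QTransfer) (hR : QLift) : _root_.PneNP := by
  by_contra hS
  have key : _root_.PneNP ↔ Literature.Computability.Complexity.Classes.P ≠ Literature.Computability.Complexity.Nondeterministic.NP :=
    Literature.Computability.Complexity.pneNP_shape_iff_P_ne_NP
  have heq : Literature.Computability.Complexity.Classes.P = Literature.Computability.Complexity.Nondeterministic.NP :=
    not_not.1 (fun hne => hS (key.2 hne))
  exact hT heq.symm.subset (hR heq.symm.subset)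

end Summit.PneNP.PneNP.Theses.RootDecompQuantumCell
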